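import Summits.ResolutionOfSingularities.ResolutionOfSingularities.Theorems.WildConesCampaignW46HypersurfacesCharTwoNearPointExists
import Summits.ResolutionOfSingularities.ResolutionOfSingularities.Theorems.WildConesCampaignW46HypersurfacesCharTwoCubicFormDefs

/-!
# [OURS · L1 W4.6, rung (ii) at p = 2, EVERY dimension n] THE CHART-VARIABLE COEFFICIENT OF THE STRICT
# TRANSFORM IS THE TANGENT CUBIC AT THE NEAR VECTOR: `[u_i] T = a₃(w)`, `w = (τ with w_i = 1)` —
# the blow-up substitution read at pure powers of the chart variable, over every field

HONEST FRAMING. Everything here is OURS: theorems about route WildCones' own TYPED point-blow-up dynamics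
(`Theorems/WildConesClassicalRegimesDefs.lean`: states `c`, `step i τ c` = blow up the point, chart `u_i`,
translate by `τ`, delete squares; `MultP` = double point; the dictionary `X_i² T = a∘Φ_{i,τ}`,
`X_pow_mul_serT_eq_subst`) and the seat's gen-5 definition `CampaignW46.degForm`
(`…HypersurfacesCharTwoCubicFormDefs.lean`: `degForm d f w = Σ_{|A|=d} [X^A]f · w^A`). NOTHING here is a
statement of the manuscript [Hironaka2017]; no FACT-LIST premise; AI review is weaker than expert review.
Cell res-hironaka (LADDER-RESOLUTION rung L, D-0089), slot W4.6, seat res-L1-s46-pv-4 (gen 5); host route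
`WildCones`, crux `ClassicalRegimes` (stmt-ResolutionOfSingularities-16884; proved).

WHY. Gen 3 read the strict transform's linear coefficients OFF the chart index: `[u_m] T = (w·P)_m`
(`coeff_single_serT_eq_vecMul`, p505045), so a double successor forces `w ∈ ker P`
(`vecMul_nearPoint_polarMatrix`, p503790). The one remaining linear coefficient, at the chart variable
itself, was only USED (`hypersurface_mu_eq_two_of_chart_linear`), never computed. This file computes it:
under the blow-up substitution `Φ_{i,τ} : X_i ↦ X_i, X_s ↦ X_i (X_s + τ_s)` the coefficient of the pure
power `X_i^d` of `f∘Φ` is the degree-`d` form of `f` at `w = (τ with w_i = 1)`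
(`coeff_single_pow_subst_blowFam_eq_degForm`), hence for a strict-transform pair `X_i² G = a∘Φ`:
`[X_i] G = a₃(w)` and `[1] G = a₂(w)` (`coeff_single_strict_self`, `constantCoeff_strict`), and for the
route's data `[u_i] T = degForm 3 (ser c) w` (`coeff_single_serT_self`). With it the seat's gen-5 file
`…NearLocus.lean` states the EXACT locus of infinitely-near double points: `w·P = 0 ∧ a₃(w) = 0`.

WHAT IS PROVED (every `n`, every field; characteristic `2` only where the dictionary needs it):

* `coeff_single_X_add_C_pow_mul`, `coeff_single_prod_X_add_C_pow` — pure `X_i`-power coefficients see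
  only the constant terms `τ_s` of factors `X_s + τ_s`, `s ≠ i`;
* `prod_blowFam_pow` — `Φ^A = X_i^{|A|} · Π_{s≠i} (X_s + τ_s)^{A_s}`;
* `coeff_single_pow_prod_blowFam` — `[X_i^d] Φ^A = [ |A| = d ] · Π_{s≠i} τ_s^{A_s}`;
* `coeff_single_pow_subst_blowFam`, `…_eq_degForm` — `[X_i^d](f∘Φ) = Σ_{|A|=d} [X^A]f Π_{s≠i} τ_s^{A_s}
  = degForm d f w`;
* `coeff_single_strict_self`, `constantCoeff_strict` — for `X_i² G = a∘Φ`: `[X_i]G = degForm 3 a w`,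
  `G(0) = degForm 2 a w`;
* `coeff_single_serT_self` — the route's strict transform: `[u_i] T = degForm 3 (ser 2 n κ c) w`.

References: G.-M. Greuel, G. Pfister, J. Algebra 689 (2026) [GreuelPfister2026] (context); H. Hironaka,
ms. 2017 [Hironaka2017] Th. 16.6 p.84 — role replaced only (the next centre), under adjudication.
-/

noncomputable section

-- single-problem summit: the doubled namespace component `ResolutionOfSingularities` is forced
set_option linter.dupNamespace false

open scoped BigOperators Classical

open MvPowerSeries IsLocalRing

open Literature.AlgebraicGeometry.Resolution

namespace Summit.ResolutionOfSingularities.ResolutionOfSingularities.Theorems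

namespace CampaignW46.HypersurfacesCharTwo

open WildCones WildCones.MuDropCharTwoOrdP ThreefoldsCharTwo

variable {κ : Type} [Field κ] {n : ℕ}

/-! ## Pure powers of the chart variable see only constant terms of the other factors -/

/-- [OURS · L1 W4.6] A multiple of another variable has no pure `X_i`-power coefficient:
`[X_i^k](X_s · h) = 0` for `s ≠ i`. [folklore] -/
theorem coeff_single_pow_X_mul_of_ne (i : Fin n) {s : Fin n} (hs : s ≠ i) (k : ℕ)
    (h : MvPowerSeries (Fin n) κ) :
    coeff (Finsupp.single i k) (X s * h) = 0 := by
  rw [X_def, coeff_monomial_mul, if_neg]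
  rw [Finsupp.single_le_iff, Finsupp.single_apply, if_neg (Ne.symm hs)]
  omega

/-- [OURS · L1 W4.6] `[X_i^k]((X_s + t) · h) = t · [X_i^k] h` for `s ≠ i`. [folklore] -/
theorem coeff_single_pow_X_add_C_mul (i : Fin n) {s : Fin n} (hs : s ≠ i) (t : κ) (k : ℕ)
    (h : MvPowerSeries (Fin n) κ) :
    coeff (Finsupp.single i k) ((X s + C t) * h) = t * coeff (Finsupp.single i k) h := by
  rw [add_mul, map_add, coeff_single_pow_X_mul_of_ne i hs, zero_add, coeff_C_mul]

/-- [OURS · L1 W4.6] `[X_i^k]((X_s + t)^m · h) = t^m · [X_i^k] h` for `s ≠ i`. [folklore] -/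
theorem coeff_single_pow_X_add_C_pow_mul (i : Fin n) {s : Fin n} (hs : s ≠ i) (t : κ) (k : ℕ)
    (m : ℕ) (h : MvPowerSeries (Fin n) κ) :
    coeff (Finsupp.single i k) ((X s + C t) ^ m * h) = t ^ m * coeff (Finsupp.single i k) h := by
  induction m generalizing h with
  | zero => rw [pow_zero, one_mul, pow_zero, one_mul]
  | succ m ih =>
    rw [pow_succ, mul_assoc, ih, coeff_single_pow_X_add_C_mul i hs, pow_succ, mul_assoc]

/-- [OURS · L1 W4.6] Pure `X_i`-power coefficients of `Π_{s ∈ S} (X_s + τ_s)^{A_s}`, `i ∉ S`: the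
constant term `Π τ_s^{A_s}` at `k = 0`, nothing at `k > 0`. [folklore] -/
theorem coeff_single_pow_prod_X_add_C_pow (i : Fin n) (τ : Fin n → κ) (A : Fin n → ℕ) (k : ℕ)
    (S : Finset (Fin n)) (hS : i ∉ S) :
    coeff (Finsupp.single i k) (∏ s ∈ S, ((X s : MvPowerSeries (Fin n) κ) + C (τ s)) ^ (A s)) =
      if k = 0 then ∏ s ∈ S, τ s ^ (A s) else 0 := by
  induction S using Finset.induction_on with
  | empty =>
    rw [Finset.prod_empty, Finset.prod_empty, coeff_one]
    by_cases hk : k = 0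
    · rw [if_pos hk, if_pos (by rw [hk, Finsupp.single_zero])]
    · rw [if_neg hk, if_neg (fun h => hk (Finsupp.single_eq_zero.mp h))]
  | insert b S hbS ih =>
    have hb : b ≠ i := fun h => hS (by rw [h]; exact Finset.mem_insert_self _ _)
    have hS' : i ∉ S := fun h => hS (Finset.mem_insert_of_mem h)
    rw [Finset.prod_insert hbS, Finset.prod_insert hbS, coeff_single_pow_X_add_C_pow_mul i hb,
      ih hS']
    by_cases hk : k = 0
    · rw [if_pos hk, if_pos hk]
    · rw [if_neg hk, if_neg hk, mul_zero]

/-! ## The blow-up family at pure powers of the chart variable -/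

/-- [OURS · L1 W4.6] The monomial `Φ^A` of the blow-up family:
`Π_s Φ_s^{A_s} = X_i^{|A|} · Π_{s ≠ i} (X_s + τ_s)^{A_s}`. [folklore] -/
theorem prod_blowFam_pow (i : Fin n) (τ : Fin n → κ) (A : Fin n →₀ ℕ) :
    (A.prod fun s m => ((fun s => if s = i then (X i : MvPowerSeries (Fin n) κ)
      else X i * (X s + C (τ s))) s) ^ m) =
      X i ^ A.degree * ∏ s ∈ Finset.univ.erase i, ((X s : MvPowerSeries (Fin n) κ) + C (τ s)) ^ (A s) := by
  rw [Finsupp.prod_fintype _ _ (fun s => pow_zero _), ← Finset.mul_prod_erase _ _ (Finset.mem_univ i)]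
  simp only [if_true]
  have h : ∏ s ∈ Finset.univ.erase i, ((fun s => if s = i then (X i : MvPowerSeries (Fin n) κ)
      else X i * (X s + C (τ s))) s) ^ (A s) =
      ∏ s ∈ Finset.univ.erase i, ((X i : MvPowerSeries (Fin n) κ) ^ (A s) * (X s + C (τ s)) ^ (A s)) := by
    refine Finset.prod_congr rfl fun s hs => ?_
    simp only [if_neg (Finset.ne_of_mem_erase hs), mul_pow]
  rw [h, Finset.prod_mul_distrib, Finset.prod_pow_eq_pow_sum, ← mul_assoc, ← pow_add]
  congr 2
  rw [Finsupp.degree_eq_sum, Finset.add_sum_erase _ _ (Finset.mem_univ i)]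

/-- [OURS · L1 W4.6] `[X_i^d](X_i^m · h) = [m ≤ d] · [X_i^{d-m}] h`. [folklore] -/
theorem coeff_single_pow_X_pow_mul (i : Fin n) (d m : ℕ) (h : MvPowerSeries (Fin n) κ) :
    coeff (Finsupp.single i d) (X i ^ m * h) =
      if m ≤ d then coeff (Finsupp.single i (d - m)) h else 0 := by
  rw [X_pow_eq, coeff_monomial_mul]
  simp only [Finsupp.single_le_iff, Finsupp.single_eq_same, one_mul, ← Finsupp.single_tsub]

/-- [OURS · L1 W4.6] **The blow-up monomial at a pure chart power**:
`[X_i^d] Φ^A = [ |A| = d ] · Π_{s ≠ i} τ_s^{A_s}`. [folklore] -/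
theorem coeff_single_pow_prod_blowFam (i : Fin n) (τ : Fin n → κ) (A : Fin n →₀ ℕ) (d : ℕ) :
    coeff (Finsupp.single i d) (A.prod fun s m => ((fun s => if s = i then
      (X i : MvPowerSeries (Fin n) κ) else X i * (X s + C (τ s))) s) ^ m) =
      if A.degree = d then ∏ s ∈ Finset.univ.erase i, τ s ^ (A s) else 0 := by
  rw [prod_blowFam_pow, coeff_single_pow_X_pow_mul]
  by_cases hle : A.degree ≤ d
  · rw [if_pos hle, coeff_single_pow_prod_X_add_C_pow i τ A _ _ (Finset.notMem_erase i _)]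
    by_cases heq : A.degree = d
    · rw [if_pos (by omega), if_pos heq]
    · rw [if_neg (by omega), if_neg heq]
  · rw [if_neg hle, if_neg (by omega)]

/-- [OURS · L1 W4.6] The exponents of total degree `d` form `univ.finsuppAntidiag d`. [folklore] -/
theorem mem_finsuppAntidiag_univ_iff_degree' {d : ℕ} {A : Fin n →₀ ℕ} :
    A ∈ (Finset.univ : Finset (Fin n)).finsuppAntidiag d ↔ A.degree = d := by
  simp [Finset.mem_finsuppAntidiag, Finsupp.degree_eq_sum]

/-- [OURS · L1 W4.6] **The blow-up substitution at a pure chart power**: for every `f ∈ κ⟦X⟧`,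
`[X_i^d](f∘Φ_{i,τ}) = Σ_{|A| = d} [X^A] f · Π_{s ≠ i} τ_s^{A_s}` — only the degree-`d` part of `f`
contributes, through the constant terms of the translated factors. [folklore] -/
theorem coeff_single_pow_subst_blowFam (i : Fin n) (τ : Fin n → κ) (f : MvPowerSeries (Fin n) κ)
    (d : ℕ) :
    coeff (Finsupp.single i d) (subst (fun s => if s = i then (X i : MvPowerSeries (Fin n) κ)
      else X i * (X s + C (τ s))) f) =
      ∑ A ∈ (Finset.univ : Finset (Fin n)).finsuppAntidiag d,
        coeff A f * ∏ s ∈ Finset.univ.erase i, τ s ^ (A s) := by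
  rw [coeff_subst (hasSubst_blowFam i τ)]
  simp only [coeff_single_pow_prod_blowFam, smul_eq_mul, mul_ite, mul_zero]
  rw [finsum_eq_sum_of_support_subset _ (s := (Finset.univ : Finset (Fin n)).finsuppAntidiag d)]
  · refine Finset.sum_congr rfl fun A hA => ?_
    rw [if_pos (mem_finsuppAntidiag_univ_iff_degree'.mp hA)]
  · intro A hA
    rw [Function.mem_support] at hA
    rw [Finset.mem_coe, mem_finsuppAntidiag_univ_iff_degree']
    by_contra h
    exact hA (by rw [if_neg h])

/-- [OURS · L1 W4.6] The degree form at a vector with `w_i = 1` drops the `i`-th factor: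
`degForm d f (τ with i ↦ 1) = Σ_{|A| = d} [X^A] f · Π_{s ≠ i} τ_s^{A_s}`. [folklore] -/
theorem degForm_update_one (i : Fin n) (τ : Fin n → κ) (f : MvPowerSeries (Fin n) κ) (d : ℕ) :
    degForm d f (Function.update τ i 1) =
      ∑ A ∈ (Finset.univ : Finset (Fin n)).finsuppAntidiag d,
        coeff A f * ∏ s ∈ Finset.univ.erase i, τ s ^ (A s) := by
  unfold degForm
  refine Finset.sum_congr rfl fun A _ => ?_
  congr 1
  rw [← Finset.mul_prod_erase _ _ (Finset.mem_univ i), Function.update_self, one_pow, one_mul]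
  refine Finset.prod_congr rfl fun s hs => ?_
  rw [Function.update_of_ne (Finset.ne_of_mem_erase hs)]

/-- [OURS · L1 W4.6; NOT a statement of the manuscript] **THE BLOW-UP SUBSTITUTION AT A PURE CHART
POWER IS THE DEGREE FORM AT THE NEAR VECTOR**: `[X_i^d](f∘Φ_{i,τ}) = degForm d f w`,
`w = (τ with w_i = 1)` — the homogeneous coordinates of the visited point of the exceptional divisor.
[folklore] -/
theorem coeff_single_pow_subst_blowFam_eq_degForm (i : Fin n) (τ : Fin n → κ)
    (f : MvPowerSeries (Fin n) κ) (d : ℕ) :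
    coeff (Finsupp.single i d) (subst (fun s => if s = i then (X i : MvPowerSeries (Fin n) κ)
      else X i * (X s + C (τ s))) f) = degForm d f (Function.update τ i 1) := by
  rw [coeff_single_pow_subst_blowFam, degForm_update_one]

/-! ## The strict transform at the chart variable -/

/-- [OURS · L1 W4.6; NOT a statement of the manuscript] **`[X_i] G = a₃(w)`**: for a strict-transform
pair `X_i² G = a∘Φ_{i,τ}` (any field), the coefficient of the chart variable in `G` is the CUBIC FORM of
`a` at the near vector `w = (τ with w_i = 1)`: `[X_i] G = [X_i³](a∘Φ) = degForm 3 a w`. [folklore] -/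
theorem coeff_single_strict_self (i : Fin n) (τ : Fin n → κ) {a G : MvPowerSeries (Fin n) κ}
    (hG : X i ^ 2 * G = subst (fun s => if s = i then (X i : MvPowerSeries (Fin n) κ)
      else X i * (X s + C (τ s))) a) :
    coeff (Finsupp.single i 1) G = degForm 3 a (Function.update τ i 1) := by
  have h := congrArg (coeff (Finsupp.single i 3)) hG
  rw [coeff_single_pow_X_pow_mul, if_pos (by norm_num), coeff_single_pow_subst_blowFam_eq_degForm] at h
  exact h

/-- [OURS · L1 W4.6; NOT a statement of the manuscript] **`G(0) = a₂(w)`**: for a strict-transform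
pair `X_i² G = a∘Φ_{i,τ}`, the constant term of `G` is the QUADRATIC FORM of `a` at the near vector
(deleted by the cleaning in the route's dynamics: it is the `z`-shift `z ↦ z + √a₂(w)` over a perfect
field). [folklore] -/
theorem constantCoeff_strict (i : Fin n) (τ : Fin n → κ) {a G : MvPowerSeries (Fin n) κ}
    (hG : X i ^ 2 * G = subst (fun s => if s = i then (X i : MvPowerSeries (Fin n) κ)
      else X i * (X s + C (τ s))) a) :
    constantCoeff G = degForm 2 a (Function.update τ i 1) := by
  have h := congrArg (coeff (Finsupp.single i 2)) hG
  rw [coeff_single_pow_X_pow_mul, if_pos le_rfl, coeff_single_pow_subst_blowFam_eq_degForm,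
    Nat.sub_self, Finsupp.single_zero, coeff_zero_eq_constantCoeff_apply] at h
  exact h

/-- [OURS · L1 W4.6 rung (ii) at `p = 2`, every dimension; NOT a statement of the manuscript] **THE
CHART-VARIABLE COEFFICIENT OF THE ROUTE'S STRICT TRANSFORM IS THE TANGENT CUBIC AT THE NEAR VECTOR**:
for a double state `c` of `z² = a(u₁,…,uₙ)` (any field), chart `i`, translation `τ`, the series `T` of
`tr i τ 2 (dv i 2 (bl i (clean c)))` (the successor before its final cleaning) has
`[u_i] T = degForm 3 (ser 2 n κ c) w`, `w = (τ with w_i = 1)`. Together with gen 3's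
`[u_m] T = (w·P)_m` (`m ≠ i`) ALL linear coefficients of the strict transform are now explicit.
[folklore] -/
theorem coeff_single_serT_self (c : (Fin n → ℕ) → κ) (i : Fin n) (τ : Fin n → κ)
    (hM : MultP 2 n κ c) :
    coeff (Finsupp.single i 1) (show MvPowerSeries (Fin n) κ from
        fun A : Fin n →₀ ℕ => tr n κ i τ 2 (dv n κ i 2 (bl n κ i (clean 2 n κ c))) ⇑A) =
      degForm 3 (ser 2 n κ c) (Function.update τ i 1) :=
  coeff_single_strict_self i τ (X_pow_mul_serT_eq_subst c i τ hM)

/-! ## Elementary values of the degree form -/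

/-- [OURS · L1 W4.6] The degree form is additive in the series. [folklore] -/
theorem degForm_add (d : ℕ) (f g : MvPowerSeries (Fin n) κ) (w : Fin n → κ) :
    degForm d (f + g) w = degForm d f w + degForm d g w := by
  unfold degForm
  rw [← Finset.sum_add_distrib]
  refine Finset.sum_congr rfl fun A _ => ?_
  rw [map_add, add_mul]

/-- [OURS · L1 W4.6] The degree form is `κ`-linear in the series. [folklore] -/
theorem degForm_smul (d : ℕ) (r : κ) (f : MvPowerSeries (Fin n) κ) (w : Fin n → κ) :
    degForm d (r • f) w = r * degForm d f w := by
  unfold degForm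
  rw [Finset.mul_sum]
  refine Finset.sum_congr rfl fun A _ => ?_
  rw [map_smul, smul_eq_mul, mul_assoc]

/-- [OURS · L1 W4.6] The degree-`d` form of a monomial of degree `d` is the monomial function.
[folklore] -/
theorem degForm_monomial {d : ℕ} {B : Fin n →₀ ℕ} (hB : B.degree = d) (r : κ) (w : Fin n → κ) :
    degForm d (monomial B r) w = r * ∏ s, w s ^ (B s) := by
  unfold degForm
  rw [Finset.sum_eq_single B]
  · rw [coeff_monomial_same]
  · intro A _ hAB
    rw [coeff_monomial_ne hAB, zero_mul]
  · intro hB'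
    exact absurd (mem_finsuppAntidiag_univ_iff_degree'.mpr hB) hB'

/-- [OURS · L1 W4.6] The degree-`d` form of a monomial of degree `≠ d` vanishes. [folklore] -/
theorem degForm_monomial_of_ne {d : ℕ} {B : Fin n →₀ ℕ} (hB : B.degree ≠ d) (r : κ) (w : Fin n → κ) :
    degForm d (monomial B r) w = 0 := by
  unfold degForm
  refine Finset.sum_eq_zero fun A hA => ?_
  rw [coeff_monomial_ne, zero_mul]
  intro hAB
  rw [hAB, mem_finsuppAntidiag_univ_iff_degree'] at hA
  exact hB hA

/-- [OURS · L1 W4.6] **The degree form is homogeneous of degree `d`**: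
`degForm d f (r • w) = r^d · degForm d f w`. [folklore] -/
theorem degForm_smul_vec (d : ℕ) (f : MvPowerSeries (Fin n) κ) (r : κ) (w : Fin n → κ) :
    degForm d f (r • w) = r ^ d * degForm d f w := by
  unfold degForm
  rw [Finset.mul_sum]
  refine Finset.sum_congr rfl fun A hA => ?_
  have hdeg := mem_finsuppAntidiag_univ_iff_degree'.mp hA
  simp only [Pi.smul_apply, smul_eq_mul, mul_pow, Finset.prod_mul_distrib,
    Finset.prod_pow_eq_pow_sum]
  rw [← Finsupp.degree_eq_sum, hdeg]
  ring

/-- [OURS · L1 W4.6] The degree form only sees coefficients of degree `d`: series that agree in degree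
`d` have the same degree-`d` form. [folklore] -/
theorem degForm_congr {d : ℕ} {f g : MvPowerSeries (Fin n) κ}
    (h : ∀ A : Fin n →₀ ℕ, A.degree = d → coeff A f = coeff A g) (w : Fin n → κ) :
    degForm d f w = degForm d g w := by
  unfold degForm
  refine Finset.sum_congr rfl fun A hA => ?_
  rw [h A (mem_finsuppAntidiag_univ_iff_degree'.mp hA)]

end CampaignW46.HypersurfacesCharTwo

end Summit.ResolutionOfSingularities.ResolutionOfSingularities.Theorems

end
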